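import Summits.QuantumFields.YangMills.Theorems.BalabanUVNodesN11TransportOfRecordSeparated
import Summits.QuantumFields.YangMills.Theorems.BalabanUVNodesN11TStepInFibreChart

/-!
# DAG node N11 — def-T's VALUE-LEVEL T-STEP (†) AND THE REPRESENTED TOWER'S PRE-𝐑 SLOT (the LEFT side of N11's (O3′)), READ THROUGH THE BOND-PARTITION
# PRESENTATION, ARE 11a's RESTRICTED TRANSPORT OF RECORD `kernelRTOfRecord` APPLIED TO THE INNER READING OF THE GRAPH INTEGRAND

HEADER — WORK-UNIT METADATA.  Cell `pub-ymgap`, YM-PLAN Track A (HUMAN RULING D-0062), seat `pub-ymgap-dag-n11-d` (g14; R134 fan-out base seat N11 [B14], strategy s2),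
route `BalabanUVNodes` rev 25, item K1⁷ `StabilityBAtRecordR13SepCoPH` = stmt-QuantumFields-20542 (helper lane, `--kind proof --supports 20542 --as helper`, count-neutral).
[I] = [Balaban1987RG1], [III] = [Balaban1988Convergent], [IV] = [Balaban1989LargeFieldI].  Sequel, BY NAME, of dag-n11-w2 g3's `…N11TransportOfRecordSeparated` (p614048:
★★★★ `transportOfRecord_comp_glue_ae_eq_kernelRTOfRecord` ∕ `_bondsIn` ∕ `_of_innerChart` — def-T's ONE-STEP transport of record through dag-n11-e's bond-partition
presentation = 11a's `kernelRTOfRecord` on the inner reading) and dag-n08-w2 g7's `…N11TStepInFibreChart` (p613290 §4b: `tstepOfRecord_ae_eq_transportOfRecord_graph` — the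
`V′`-dependence of the step weights is immaterial `dV′`-a.e.), over node00-def-T's `Node00/TStepOfRecord` (`tstepOfRecord`, `transportOfRecord`), `Node00/RepTowerOfRecord`
(`slotsTOfRecord`, `slotsOfRecord`, `slotsTOfRecord_succ`) and 11a `Node00/TkOfRecord` (`kernelRTOfRecord`, `avgRestrOfRecord`, `genDataOfRecord`).  The piece dag-n11-w2
(I.31118 ∕ I.31407), dag-n11-e (I.31283) and dag-lead (DEDUP-389) named for this pen; INTENT-5 I.31463.

WHY THIS FILE.  N11's 𝐓-present child obligation (O3′) (`…N11Sect3SupplyChainDefs.PresentChildObligations`, last conjunct) has LEFT side the represented tower's pre-𝐑 slot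
`slotsTOfRecord … (k+1) s′ = tstepOfRecord … k (slotsOfRecord … k) s′` (`slotsTOfRecord_succ`, `rfl`), i.e. def-T's value-level T-step (†)
  `tstepOfRecord … k T s′ V′ = transportOfRecord k (U ↦ w(s′)(U,V′) · χ_k(init s′)(U) · T(init s′)(U)) V′`            (`tstepOfRecord_apply`),
whose integrand reads `V′` through the step weight.  11a's generation `𝐓^{(k)} = vOp ∘ zetaOp ∘ aOp` (`genOp`, (2.21)) transports ONLY the out-bonds `sV = bondsIn k (Ω_{k+1})ᶜ →
sV' = bondsIn (k+1) (Ω_{k+1})ᶜ` by `vT := kernelRTOfRecord sV sV'` (`genDataOfRecord`).  The separated reading of the ONE-STEP transport is in the tree PER DENSITY (p614048); (†) is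
not per density — but dag-n08-w2's graph face says `tstepOfRecord … k T s′ =ᵐ[dV′] transportOfRecord k G_{s′}` for the FIXED graph integrand
`G_{s′}(U) := w(s′)(U, Ū) · χ_k(init s′)(U) · T(init s′)(U)`.  HERE the two are composed, the `dV′`-a.e. equality being pulled back along the coarse presentation `e_α` (measure
presenting, dag-n11-e's `fieldMeasure_eq_map_piEquivPiSubtypeProd_symm`): for `k < K`, a fine region `Y` saturated at level `k+1` (`hY`; at `genDataOfRecord` `Y = (s′.Ω (k+1))ᶜ`),
finsets `sV ∕ sV'` representing its bond sets, an integrable graph integrand and a displayed inner reading `hin` of `G_{s′} ∘ e_β` (or, ★★★★′, this seat's ⊗ₘκ socket data for the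
inner step on the presented carriers),
  `(tstepOfRecord … k T s′) ∘ e_α =ᵐ[(Π_{sV'} Haar) ⊗ (Π_{sV'ᶜ} Haar)] (V_out, r) ↦ kernelRTOfRecord F N K k sV sV' (y ↦ Fᵢ (y, r)) V_out`,
and the same for `slotsTOfRecord … (k+1) s′` — THE LEFT SIDE OF (O3′), through the presentation, IS `genDataOfRecord`'s `vT` APPLIED TO THE INNER READING.  What then remains of
(B4) ∕ (O3′) at the record is the INNER identification (the inner reading `Fᵢ` versus `ζ · aOp` of `genOp`, [III] (3.10)–(3.23)) and 11a's two-scale configuration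
conventions — NOT this file.

WHAT THIS FILE PROVES (0 `def`, 0 `sorry`, standard axioms).
§1 ★★★★ `tstepOfRecord_comp_glue_ae_eq_kernelRTOfRecord` (inner reading displayed) · ★★★★ `tstepOfRecord_comp_glue_ae_eq_kernelRTOfRecord_bondsIn` (11a's exact finsets) ·
   ★★★★′ `tstepOfRecord_comp_glue_ae_eq_kernelRTOfRecord_of_innerChart` (inner fibre charted: `κ Ψ J S hpush hfib`, graph weight vanishing off `S`).
§2 ★★★★ `slotsTOfRecord_succ_comp_glue_ae_eq_kernelRTOfRecord` · `…_bondsIn` · ★★★★′ `…_of_innerChart` (the represented tower's pre-𝐑 slot = (O3′)'s left side).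

HONEST FRAMING.  Helper lane of K1⁷; count-neutral; a two-line composition BY NAME of landed faces (dag-n08-w2's graph face, dag-n11-w2's separated transport, dag-n11-e's
presentation) over def-T's ∕ 11a's definitions; `hY`, the graph integrand's integrability (`hG`) ∕ measurability and support (★★★★′), the inner reading `hin` ∕ the inner
chart are DISPLAYED hypotheses; NO chart of Bałaban's constructed, NO Jacobian computed, the inner identification with `ζ · aOp` NOT made; nothing of [I] §2 ∕ [III] §3
(3.10)–(3.25) asserted; (B4) ∕ (S-α) ∕ (O3′) NOT closed; N11 NOT discharged; K1⁷ NOT closed; counts unmoved (typed 28∕28 · discharged 5∕27 · A 5∕28).  One finite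
`𝕋⁴_{L^K}` programme at fixed `ε = L^{−K}`; R4 closes only the conditional finite-𝕋⁴ rung `BalabanLadder.UV` — NOT ℝ⁴, NOT OS, NOT a mass gap, NOT Clay.  No `sorry`, `axiom`,
`def`, `instance`, `notation`.  Sources (SHAPE ∕ bookkeeping only): [III] (2.21) p.258, (3.1) p.264, (3.2)–(3.5) p.265, (3.23)–(3.25) p.270; [I] (0.4) p.253; [IV] (0.2)–(0.3) p.176.
-/

noncomputable section

open MeasureTheory ProbabilityTheory
open scoped ENNReal NNReal

namespace Summit.QuantumFields.YangMills.Theorems.BalabanUVNodesN11TStepOfRecordSeparated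

open Literature.MathematicalPhysics.QuantumFieldTheory.Balaban1983to89
open Literature.MathematicalPhysics.QuantumFieldTheory.Balaban1983to89.T4AveragingDisintegration
open BalabanUVNodesN11TransportOfRecordSeparated (transportOfRecord_comp_glue_ae_eq_kernelRTOfRecord transportOfRecord_comp_glue_ae_eq_kernelRTOfRecord_bondsIn
  transportOfRecord_comp_glue_ae_eq_kernelRTOfRecord_of_innerChart)
open BalabanUVNodesN11TStepInFibreChart (tstepOfRecord_ae_eq_transportOfRecord_graph)
open Node00 hiding SU
open T4Continuum
open B10Eq42TorusConstraint (bondsIn)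
open B10Eq38TorusDomains (toFine)

variable {F : T4Family} {N : ℕ} [NeZero N]

/-! ## §1  def-T's value-level T-step (†) through the coarse presentation -/

section TStep

/-- ★★★★ **def-T's VALUE-LEVEL T-STEP (†), READ THROUGH THE BOND-PARTITION PRESENTATION, IS 11a's `kernelRTOfRecord` APPLIED TO THE INNER READING OF THE GRAPH
INTEGRAND.**  At step `k < K` of the `K`-th torus of the run `p`, let `Y` be a fine region saturated at level `k+1` (`hY`; at `genDataOfRecord` `Y = (Ω_{k+1})ᶜ`) and `sV`,
`sV'` finsets representing its level-`k` ∕ level-`(k+1)` bond sets; let `T` be any level-`k` slot family and `s′` a new sequence.  If the GRAPH integrand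
`G_{s′}(U) = w(s′)(U, Ū) · χ_k(init s′)(U) · T(init s′)(U)` is `dU`-integrable and `hin` displays an inner reading `Fᵢ` of `G_{s′} ∘ e_β` along the inner step, then
`(tstepOfRecord … k T s′) ∘ e_α =ᵐ[(Π_{sV'} Haar) ⊗ (Π_{sV'ᶜ} Haar)] (V_out, r) ↦ kernelRTOfRecord F N K k sV sV' (y ↦ Fᵢ (y, r)) V_out`.
Proof: dag-n08-w2's graph face `tstepOfRecord_ae_eq_transportOfRecord_graph` pulled back along the measure-presenting `e_α` (dag-n11-e's
`fieldMeasure_eq_map_piEquivPiSubtypeProd_symm`, Mathlib `QuasiMeasurePreserving.ae_eq_comp`), then dag-n11-w2's `transportOfRecord_comp_glue_ae_eq_kernelRTOfRecord` at the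
fixed density `G_{s′}`. [cite: Balaban1988Convergent, (2.21) p.258, (3.1) p.264, (3.2)–(3.5) p.265, (3.24)–(3.25) p.270 (bookkeeping)] -/
theorem tstepOfRecord_comp_glue_ae_eq_kernelRTOfRecord (ν : Stage7Numerics) (M : ℕ) (w : StepWeightsOfRecord F N ν M) (p : B12.RunParams) (g : ℕ → ℝ)
    {k : ℕ} (hkK : k < p.K) [DecidableEq (PBond (F.P p.K) k)] [DecidableEq (PBond (F.P p.K) (k + 1))] (hk : k + 1 ≤ (F.P p.K).m + (F.P p.K).K)
    (T : SeqOfRecord F ν M g p.K k → Density (F.P p.K) k (SU N)) (s' : SeqOfRecord F ν M g p.K (k + 1))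
    {Y : Set (Site (F.P p.K) 0)} (hY : ∀ s : Site (F.P p.K) k, toFine k s ∈ Y ↔ toFine (k + 1) (blockOf s) ∈ Y)
    {sV : Finset (PBond (F.P p.K) k)} (hsV : ∀ b : PBond (F.P p.K) k, b ∈ sV ↔ b ∈ bondsIn k Y)
    {sV' : Finset (PBond (F.P p.K) (k + 1))} (hsV' : ∀ c : PBond (F.P p.K) (k + 1), c ∈ sV' ↔ c ∈ bondsIn (k + 1) Y)
    (hG : Integrable (fun U => w p g k s' U ((avOfRecord F N p.K k).avg U) * (chiSeqOfRecord F N ν M g p.K k s'.init U * T s'.init U))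
      (fieldMeasure (F.P p.K) k (SU N)))
    {Fᵢ : (↥sV → SU N) × ({c : PBond (F.P p.K) (k + 1) // c ∉ sV'} → SU N) → ℝ} (hFm : Measurable Fᵢ)
    (hin : kernelTransport
        ((Measure.pi fun _ : ↥sV => (HaarData.haar : Measure (SU N))).prod
          (Measure.pi fun _ : {b : PBond (F.P p.K) k // b ∉ sV} => (HaarData.haar : Measure (SU N))))
        ((Measure.pi fun _ : ↥sV => (HaarData.haar : Measure (SU N))).prod
          (Measure.pi fun _ : {c : PBond (F.P p.K) (k + 1) // c ∉ sV'} => (HaarData.haar : Measure (SU N))))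
        (fun q => (q.1, fun c : {c : PBond (F.P p.K) (k + 1) // c ∉ sV'} =>
          (avOfRecord F N p.K k).avg ((MeasurableEquiv.piEquivPiSubtypeProd (fun _ : PBond (F.P p.K) k => SU N) (· ∈ sV)).symm q) c))
        ((fun U => w p g k s' U ((avOfRecord F N p.K k).avg U) * (chiSeqOfRecord F N ν M g p.K k s'.init U * T s'.init U)) ∘
          ⇑(MeasurableEquiv.piEquivPiSubtypeProd (fun _ : PBond (F.P p.K) k => SU N) (· ∈ sV)).symm)
      =ᵐ[(Measure.pi fun _ : ↥sV => (HaarData.haar : Measure (SU N))).prod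
          (Measure.pi fun _ : {c : PBond (F.P p.K) (k + 1) // c ∉ sV'} => (HaarData.haar : Measure (SU N)))] Fᵢ) :
    (tstepOfRecord F N ν M w p g k T s') ∘ ⇑(MeasurableEquiv.piEquivPiSubtypeProd (fun _ : PBond (F.P p.K) (k + 1) => SU N) (· ∈ sV')).symm
      =ᵐ[(Measure.pi fun _ : ↥sV' => (HaarData.haar : Measure (SU N))).prod
          (Measure.pi fun _ : {c : PBond (F.P p.K) (k + 1) // c ∉ sV'} => (HaarData.haar : Measure (SU N)))]
        fun q => kernelRTOfRecord F N p.K k sV sV' (fun y => Fᵢ (y, q.2)) q.1 := by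
  -- the coarse presentation presents `fieldMeasure (k+1)` (dag-n11-e), so `dV′`-a.e. equalities pull back along it
  have hpres : MeasurePreserving (⇑(MeasurableEquiv.piEquivPiSubtypeProd (fun _ : PBond (F.P p.K) (k + 1) => SU N) (· ∈ sV')).symm)
      ((Measure.pi fun _ : ↥sV' => (HaarData.haar : Measure (SU N))).prod
        (Measure.pi fun _ : {c : PBond (F.P p.K) (k + 1) // c ∉ sV'} => (HaarData.haar : Measure (SU N))))
      (fieldMeasure (F.P p.K) (k + 1) (SU N)) :=
    ⟨(MeasurableEquiv.piEquivPiSubtypeProd (fun _ : PBond (F.P p.K) (k + 1) => SU N) (· ∈ sV')).symm.measurable,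
      (fieldMeasure_eq_map_piEquivPiSubtypeProd_symm sV').symm⟩
  -- dag-n08-w2's graph face: (†) is the transport of the FIXED graph integrand, `dV′`-a.e.
  have hgraph := hpres.quasiMeasurePreserving.ae_eq_comp (tstepOfRecord_ae_eq_transportOfRecord_graph ν M w p g hkK T s')
  -- dag-n11-w2's separated transport at that density
  exact hgraph.trans (transportOfRecord_comp_glue_ae_eq_kernelRTOfRecord F N p.K k hkK hk hY hsV hsV' hG hFm hin)

/-- ★★★★ The same AT 11a's EXACT BOND SETS `(Set.toFinite (bondsIn k Y)).toFinset` ∕ `(Set.toFinite (bondsIn (k+1) Y)).toFinset` — `genDataOfRecord`'s `sV ∕ sV'` at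
`Y = (Ω_{k+1})ᶜ`: only `hY`, `hG` and the inner reading `hin` displayed. [cite: Balaban1988Convergent, (2.21) p.258, (3.1) p.264 (bookkeeping)] -/
theorem tstepOfRecord_comp_glue_ae_eq_kernelRTOfRecord_bondsIn (ν : Stage7Numerics) (M : ℕ) (w : StepWeightsOfRecord F N ν M) (p : B12.RunParams) (g : ℕ → ℝ)
    {k : ℕ} (hkK : k < p.K) [DecidableEq (PBond (F.P p.K) k)] [DecidableEq (PBond (F.P p.K) (k + 1))] (hk : k + 1 ≤ (F.P p.K).m + (F.P p.K).K)
    (T : SeqOfRecord F ν M g p.K k → Density (F.P p.K) k (SU N)) (s' : SeqOfRecord F ν M g p.K (k + 1))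
    {Y : Set (Site (F.P p.K) 0)} (hY : ∀ s : Site (F.P p.K) k, toFine k s ∈ Y ↔ toFine (k + 1) (blockOf s) ∈ Y)
    (hG : Integrable (fun U => w p g k s' U ((avOfRecord F N p.K k).avg U) * (chiSeqOfRecord F N ν M g p.K k s'.init U * T s'.init U))
      (fieldMeasure (F.P p.K) k (SU N)))
    {Fᵢ : (↥(Set.toFinite (bondsIn k Y)).toFinset → SU N) ×
        ({c : PBond (F.P p.K) (k + 1) // c ∉ (Set.toFinite (bondsIn (k + 1) Y)).toFinset} → SU N) → ℝ} (hFm : Measurable Fᵢ)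
    (hin : kernelTransport
        ((Measure.pi fun _ : ↥(Set.toFinite (bondsIn k Y)).toFinset => (HaarData.haar : Measure (SU N))).prod
          (Measure.pi fun _ : {b : PBond (F.P p.K) k // b ∉ (Set.toFinite (bondsIn k Y)).toFinset} => (HaarData.haar : Measure (SU N))))
        ((Measure.pi fun _ : ↥(Set.toFinite (bondsIn k Y)).toFinset => (HaarData.haar : Measure (SU N))).prod
          (Measure.pi fun _ : {c : PBond (F.P p.K) (k + 1) // c ∉ (Set.toFinite (bondsIn (k + 1) Y)).toFinset} =>
            (HaarData.haar : Measure (SU N))))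
        (fun q => (q.1, fun c : {c : PBond (F.P p.K) (k + 1) // c ∉ (Set.toFinite (bondsIn (k + 1) Y)).toFinset} =>
          (avOfRecord F N p.K k).avg
            ((MeasurableEquiv.piEquivPiSubtypeProd (fun _ : PBond (F.P p.K) k => SU N)
              (· ∈ (Set.toFinite (bondsIn k Y)).toFinset)).symm q) c))
        ((fun U => w p g k s' U ((avOfRecord F N p.K k).avg U) * (chiSeqOfRecord F N ν M g p.K k s'.init U * T s'.init U)) ∘
          ⇑(MeasurableEquiv.piEquivPiSubtypeProd (fun _ : PBond (F.P p.K) k => SU N)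
            (· ∈ (Set.toFinite (bondsIn k Y)).toFinset)).symm)
      =ᵐ[(Measure.pi fun _ : ↥(Set.toFinite (bondsIn k Y)).toFinset => (HaarData.haar : Measure (SU N))).prod
          (Measure.pi fun _ : {c : PBond (F.P p.K) (k + 1) // c ∉ (Set.toFinite (bondsIn (k + 1) Y)).toFinset} =>
            (HaarData.haar : Measure (SU N)))] Fᵢ) :
    (tstepOfRecord F N ν M w p g k T s') ∘
        ⇑(MeasurableEquiv.piEquivPiSubtypeProd (fun _ : PBond (F.P p.K) (k + 1) => SU N)
          (· ∈ (Set.toFinite (bondsIn (k + 1) Y)).toFinset)).symm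
      =ᵐ[(Measure.pi fun _ : ↥(Set.toFinite (bondsIn (k + 1) Y)).toFinset => (HaarData.haar : Measure (SU N))).prod
          (Measure.pi fun _ : {c : PBond (F.P p.K) (k + 1) // c ∉ (Set.toFinite (bondsIn (k + 1) Y)).toFinset} =>
            (HaarData.haar : Measure (SU N)))]
        fun q => kernelRTOfRecord F N p.K k (Set.toFinite (bondsIn k Y)).toFinset (Set.toFinite (bondsIn (k + 1) Y)).toFinset
          (fun y => Fᵢ (y, q.2)) q.1 :=
  tstepOfRecord_comp_glue_ae_eq_kernelRTOfRecord ν M w p g hkK hk T s' hY (fun b => mem_toFinite_bondsIn_toFinset_iff Y b)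
    (fun c => mem_toFinite_bondsIn_toFinset_iff Y c) hG hFm hin

/-- ★★★★′ **def-T's (†) THROUGH THE PRESENTATION, INNER FIBRE CHARTED** — instead of a displayed inner reading, this seat's ⊗ₘκ socket data for the inner step on the
presented carriers (fibre references `κ (y, r)` on a parameter space `X`, inside configuration `Ψ ((y, r), x)` of the bonds off `sV`, Jacobian weight `J`, charted set `S` with
`hpush` ∕ `hfib`), a measurable graph section of the step weight VANISHING OFF `S` in the presented coordinates (`hwS` — the window of (3.2)–(3.5) around the new field),
measurable `χ_k(init s′)` and `T(init s′)`, and the integrable graph integrand: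
`(tstepOfRecord … k T s′) ∘ e_α =ᵐ (V_out, r) ↦ kernelRTOfRecord F N K k sV sV' [y ↦ ∫ J((y,r),x) · G_{s′}(e_β (y, Ψ((y,r),x))) ∂κ(y,r)] V_out` with
`G_{s′} = w(s′)(·, avg ·) · χ_k(init s′) · T(init s′)` — «outside variables by 11a's un-charted restricted transport of record, the (†)-integrand read at the chart point inside»
(dag-n11-w2's `transportOfRecord_comp_glue_ae_eq_kernelRTOfRecord_of_innerChart` after dag-n08-w2's graph face).
[cite: Balaban1988Convergent, (2.21) p.258, (3.1) p.264, (3.2)–(3.5) p.265, (3.23)–(3.25) p.270; Balaban1987RG1, (0.4) p.253 (bookkeeping)] -/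
theorem tstepOfRecord_comp_glue_ae_eq_kernelRTOfRecord_of_innerChart (ν : Stage7Numerics) (M : ℕ) (w : StepWeightsOfRecord F N ν M) (p : B12.RunParams)
    (g : ℕ → ℝ) {k : ℕ} (hkK : k < p.K) [DecidableEq (PBond (F.P p.K) k)] [DecidableEq (PBond (F.P p.K) (k + 1))] (hk : k + 1 ≤ (F.P p.K).m + (F.P p.K).K)
    (T : SeqOfRecord F ν M g p.K k → Density (F.P p.K) k (SU N)) (s' : SeqOfRecord F ν M g p.K (k + 1))
    {Y : Set (Site (F.P p.K) 0)} (hY : ∀ s : Site (F.P p.K) k, toFine k s ∈ Y ↔ toFine (k + 1) (blockOf s) ∈ Y)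
    {sV : Finset (PBond (F.P p.K) k)} (hsV : ∀ b : PBond (F.P p.K) k, b ∈ sV ↔ b ∈ bondsIn k Y)
    {sV' : Finset (PBond (F.P p.K) (k + 1))} (hsV' : ∀ c : PBond (F.P p.K) (k + 1), c ∈ sV' ↔ c ∈ bondsIn (k + 1) Y)
    {X : Type*} [MeasurableSpace X]
    {κ : Kernel ((↥sV → SU N) × ({c : PBond (F.P p.K) (k + 1) // c ∉ sV'} → SU N)) X} [IsSFiniteKernel κ]
    {Ψ : ((↥sV → SU N) × ({c : PBond (F.P p.K) (k + 1) // c ∉ sV'} → SU N)) × X → ({b : PBond (F.P p.K) k // b ∉ sV} → SU N)}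
    (hΨ : Measurable Ψ)
    {J : ((↥sV → SU N) × ({c : PBond (F.P p.K) (k + 1) // c ∉ sV'} → SU N)) × X → ℝ≥0} (hJ : Measurable J)
    {S : Set ((↥sV → SU N) × ({b : PBond (F.P p.K) k // b ∉ sV} → SU N))}
    (hpush : ((((Measure.pi fun _ : ↥sV => (HaarData.haar : Measure (SU N))).prod
          (Measure.pi fun _ : {c : PBond (F.P p.K) (k + 1) // c ∉ sV'} => (HaarData.haar : Measure (SU N)))) ⊗ₘ κ).withDensity
          (fun z => (J z : ℝ≥0∞))).map (fun z => (z.1.1, Ψ z))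
      = ((Measure.pi fun _ : ↥sV => (HaarData.haar : Measure (SU N))).prod
          (Measure.pi fun _ : {b : PBond (F.P p.K) k // b ∉ sV} => (HaarData.haar : Measure (SU N)))).restrict S)
    (hfib : ∀ᵐ z ∂((((Measure.pi fun _ : ↥sV => (HaarData.haar : Measure (SU N))).prod
          (Measure.pi fun _ : {c : PBond (F.P p.K) (k + 1) // c ∉ sV'} => (HaarData.haar : Measure (SU N)))) ⊗ₘ κ).withDensity
          (fun z => (J z : ℝ≥0∞))),
      (fun c : {c : PBond (F.P p.K) (k + 1) // c ∉ sV'} =>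
        (avOfRecord F N p.K k).avg ((MeasurableEquiv.piEquivPiSubtypeProd (fun _ : PBond (F.P p.K) k => SU N) (· ∈ sV)).symm
          (z.1.1, Ψ z)) c) = z.1.2)
    (hw : Measurable fun U => w p g k s' U ((avOfRecord F N p.K k).avg U)) (hχ : Measurable (chiSeqOfRecord F N ν M g p.K k s'.init))
    (hT : Measurable (T s'.init))
    (hG : Integrable (fun U => w p g k s' U ((avOfRecord F N p.K k).avg U) * (chiSeqOfRecord F N ν M g p.K k s'.init U * T s'.init U))
      (fieldMeasure (F.P p.K) k (SU N)))
    (hwS : ∀ q, q ∉ S →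
      w p g k s' ((MeasurableEquiv.piEquivPiSubtypeProd (fun _ : PBond (F.P p.K) k => SU N) (· ∈ sV)).symm q)
        ((avOfRecord F N p.K k).avg ((MeasurableEquiv.piEquivPiSubtypeProd (fun _ : PBond (F.P p.K) k => SU N) (· ∈ sV)).symm q)) = 0) :
    (tstepOfRecord F N ν M w p g k T s') ∘ ⇑(MeasurableEquiv.piEquivPiSubtypeProd (fun _ : PBond (F.P p.K) (k + 1) => SU N) (· ∈ sV')).symm
      =ᵐ[(Measure.pi fun _ : ↥sV' => (HaarData.haar : Measure (SU N))).prod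
          (Measure.pi fun _ : {c : PBond (F.P p.K) (k + 1) // c ∉ sV'} => (HaarData.haar : Measure (SU N)))]
        fun v => kernelRTOfRecord F N p.K k sV sV'
          (fun y => ∫ x, (J ((y, v.2), x) : ℝ) *
            (fun U => w p g k s' U ((avOfRecord F N p.K k).avg U) * (chiSeqOfRecord F N ν M g p.K k s'.init U * T s'.init U))
              ((MeasurableEquiv.piEquivPiSubtypeProd (fun _ : PBond (F.P p.K) k => SU N) (· ∈ sV)).symm (y, Ψ ((y, v.2), x))) ∂(κ (y, v.2)))
          v.1 := by
  have hpres : MeasurePreserving (⇑(MeasurableEquiv.piEquivPiSubtypeProd (fun _ : PBond (F.P p.K) (k + 1) => SU N) (· ∈ sV')).symm)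
      ((Measure.pi fun _ : ↥sV' => (HaarData.haar : Measure (SU N))).prod
        (Measure.pi fun _ : {c : PBond (F.P p.K) (k + 1) // c ∉ sV'} => (HaarData.haar : Measure (SU N))))
      (fieldMeasure (F.P p.K) (k + 1) (SU N)) :=
    ⟨(MeasurableEquiv.piEquivPiSubtypeProd (fun _ : PBond (F.P p.K) (k + 1) => SU N) (· ∈ sV')).symm.measurable,
      (fieldMeasure_eq_map_piEquivPiSubtypeProd_symm sV').symm⟩
  have hgraph := hpres.quasiMeasurePreserving.ae_eq_comp (tstepOfRecord_ae_eq_transportOfRecord_graph ν M w p g hkK T s')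
  have hGm : Measurable fun U => w p g k s' U ((avOfRecord F N p.K k).avg U) * (chiSeqOfRecord F N ν M g p.K k s'.init U * T s'.init U) :=
    hw.mul (hχ.mul hT)
  exact hgraph.trans (transportOfRecord_comp_glue_ae_eq_kernelRTOfRecord_of_innerChart F N p.K k hkK hk hY hsV hsV' hΨ hJ hpush hfib hGm hG
    fun q hq => by simp only [hwS q hq, zero_mul])

end TStep

/-! ## §2  The represented tower's pre-𝐑 slot at level `k+1` — the LEFT side of (O3′) — through the coarse presentation -/

section Slots

/-- ★★★★ **THE LEFT SIDE OF N11's (O3′), READ THROUGH THE BOND-PARTITION PRESENTATION, IS 11a's `kernelRTOfRecord` ON THE INNER READING**: for the represented tower of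
record (`slotsTOfRecord … (k+1) s′ = tstepOfRecord … k (slotsOfRecord … k) s′`, `slotsTOfRecord_succ`), with the graph integrand
`w(s′)(·, avg ·) · χ_k(init s′) · slot_k(init s′)` integrable and its inner reading `Fᵢ` displayed,
`(slotsTOfRecord … (k+1) s′) ∘ e_α =ᵐ (V_out, r) ↦ kernelRTOfRecord F N K k sV sV' (y ↦ Fᵢ (y, r)) V_out`.
[cite: Balaban1988Convergent, (2.21) p.258, (3.1) p.264, (3.24)–(3.25) p.270; Balaban1989LargeFieldI, (0.2)–(0.3) p.176 (bookkeeping)] -/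
theorem slotsTOfRecord_succ_comp_glue_ae_eq_kernelRTOfRecord (ν : Stage7Numerics) (τ : TowerNumerics) (E : B12.RunParams → ℝ) (w : StepWeightsOfRecord F N ν τ.M)
    (ppSel : PpSelOfRecord F ν τ.M) (p : B12.RunParams) (g : ℕ → ℝ) {k : ℕ} (hkK : k < p.K)
    [DecidableEq (PBond (F.P p.K) k)] [DecidableEq (PBond (F.P p.K) (k + 1))] (hk : k + 1 ≤ (F.P p.K).m + (F.P p.K).K) (s' : SeqOfRecord F ν τ.M g p.K (k + 1))
    {Y : Set (Site (F.P p.K) 0)} (hY : ∀ s : Site (F.P p.K) k, toFine k s ∈ Y ↔ toFine (k + 1) (blockOf s) ∈ Y)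
    {sV : Finset (PBond (F.P p.K) k)} (hsV : ∀ b : PBond (F.P p.K) k, b ∈ sV ↔ b ∈ bondsIn k Y)
    {sV' : Finset (PBond (F.P p.K) (k + 1))} (hsV' : ∀ c : PBond (F.P p.K) (k + 1), c ∈ sV' ↔ c ∈ bondsIn (k + 1) Y)
    (hG : Integrable (fun U => w p g k s' U ((avOfRecord F N p.K k).avg U) *
      (chiSeqOfRecord F N ν τ.M g p.K k s'.init U * slotsOfRecord F N ν τ E w ppSel p g k s'.init U)) (fieldMeasure (F.P p.K) k (SU N)))
    {Fᵢ : (↥sV → SU N) × ({c : PBond (F.P p.K) (k + 1) // c ∉ sV'} → SU N) → ℝ} (hFm : Measurable Fᵢ)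
    (hin : kernelTransport
        ((Measure.pi fun _ : ↥sV => (HaarData.haar : Measure (SU N))).prod
          (Measure.pi fun _ : {b : PBond (F.P p.K) k // b ∉ sV} => (HaarData.haar : Measure (SU N))))
        ((Measure.pi fun _ : ↥sV => (HaarData.haar : Measure (SU N))).prod
          (Measure.pi fun _ : {c : PBond (F.P p.K) (k + 1) // c ∉ sV'} => (HaarData.haar : Measure (SU N))))
        (fun q => (q.1, fun c : {c : PBond (F.P p.K) (k + 1) // c ∉ sV'} =>
          (avOfRecord F N p.K k).avg ((MeasurableEquiv.piEquivPiSubtypeProd (fun _ : PBond (F.P p.K) k => SU N) (· ∈ sV)).symm q) c))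
        ((fun U => w p g k s' U ((avOfRecord F N p.K k).avg U) *
            (chiSeqOfRecord F N ν τ.M g p.K k s'.init U * slotsOfRecord F N ν τ E w ppSel p g k s'.init U)) ∘
          ⇑(MeasurableEquiv.piEquivPiSubtypeProd (fun _ : PBond (F.P p.K) k => SU N) (· ∈ sV)).symm)
      =ᵐ[(Measure.pi fun _ : ↥sV => (HaarData.haar : Measure (SU N))).prod
          (Measure.pi fun _ : {c : PBond (F.P p.K) (k + 1) // c ∉ sV'} => (HaarData.haar : Measure (SU N)))] Fᵢ) :
    (slotsTOfRecord F N ν τ E w ppSel p g (k + 1) s') ∘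
        ⇑(MeasurableEquiv.piEquivPiSubtypeProd (fun _ : PBond (F.P p.K) (k + 1) => SU N) (· ∈ sV')).symm
      =ᵐ[(Measure.pi fun _ : ↥sV' => (HaarData.haar : Measure (SU N))).prod
          (Measure.pi fun _ : {c : PBond (F.P p.K) (k + 1) // c ∉ sV'} => (HaarData.haar : Measure (SU N)))]
        fun q => kernelRTOfRecord F N p.K k sV sV' (fun y => Fᵢ (y, q.2)) q.1 := by
  rw [slotsTOfRecord_succ]
  exact tstepOfRecord_comp_glue_ae_eq_kernelRTOfRecord ν τ.M w p g hkK hk (slotsOfRecord F N ν τ E w ppSel p g k) s' hY hsV hsV' hG hFm hin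

/-- ★★★★ The same at 11a's exact bond sets of `Y` (`genDataOfRecord`'s `sV ∕ sV'` at `Y = (Ω_{k+1})ᶜ`).
[cite: Balaban1988Convergent, (2.21) p.258, (3.24)–(3.25) p.270 (bookkeeping)] -/
theorem slotsTOfRecord_succ_comp_glue_ae_eq_kernelRTOfRecord_bondsIn (ν : Stage7Numerics) (τ : TowerNumerics) (E : B12.RunParams → ℝ)
    (w : StepWeightsOfRecord F N ν τ.M) (ppSel : PpSelOfRecord F ν τ.M) (p : B12.RunParams) (g : ℕ → ℝ) {k : ℕ} (hkK : k < p.K)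
    [DecidableEq (PBond (F.P p.K) k)] [DecidableEq (PBond (F.P p.K) (k + 1))] (hk : k + 1 ≤ (F.P p.K).m + (F.P p.K).K) (s' : SeqOfRecord F ν τ.M g p.K (k + 1))
    {Y : Set (Site (F.P p.K) 0)} (hY : ∀ s : Site (F.P p.K) k, toFine k s ∈ Y ↔ toFine (k + 1) (blockOf s) ∈ Y)
    (hG : Integrable (fun U => w p g k s' U ((avOfRecord F N p.K k).avg U) *
      (chiSeqOfRecord F N ν τ.M g p.K k s'.init U * slotsOfRecord F N ν τ E w ppSel p g k s'.init U)) (fieldMeasure (F.P p.K) k (SU N)))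
    {Fᵢ : (↥(Set.toFinite (bondsIn k Y)).toFinset → SU N) ×
        ({c : PBond (F.P p.K) (k + 1) // c ∉ (Set.toFinite (bondsIn (k + 1) Y)).toFinset} → SU N) → ℝ} (hFm : Measurable Fᵢ)
    (hin : kernelTransport
        ((Measure.pi fun _ : ↥(Set.toFinite (bondsIn k Y)).toFinset => (HaarData.haar : Measure (SU N))).prod
          (Measure.pi fun _ : {b : PBond (F.P p.K) k // b ∉ (Set.toFinite (bondsIn k Y)).toFinset} => (HaarData.haar : Measure (SU N))))
        ((Measure.pi fun _ : ↥(Set.toFinite (bondsIn k Y)).toFinset => (HaarData.haar : Measure (SU N))).prod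
          (Measure.pi fun _ : {c : PBond (F.P p.K) (k + 1) // c ∉ (Set.toFinite (bondsIn (k + 1) Y)).toFinset} =>
            (HaarData.haar : Measure (SU N))))
        (fun q => (q.1, fun c : {c : PBond (F.P p.K) (k + 1) // c ∉ (Set.toFinite (bondsIn (k + 1) Y)).toFinset} =>
          (avOfRecord F N p.K k).avg
            ((MeasurableEquiv.piEquivPiSubtypeProd (fun _ : PBond (F.P p.K) k => SU N)
              (· ∈ (Set.toFinite (bondsIn k Y)).toFinset)).symm q) c))
        ((fun U => w p g k s' U ((avOfRecord F N p.K k).avg U) *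
            (chiSeqOfRecord F N ν τ.M g p.K k s'.init U * slotsOfRecord F N ν τ E w ppSel p g k s'.init U)) ∘
          ⇑(MeasurableEquiv.piEquivPiSubtypeProd (fun _ : PBond (F.P p.K) k => SU N)
            (· ∈ (Set.toFinite (bondsIn k Y)).toFinset)).symm)
      =ᵐ[(Measure.pi fun _ : ↥(Set.toFinite (bondsIn k Y)).toFinset => (HaarData.haar : Measure (SU N))).prod
          (Measure.pi fun _ : {c : PBond (F.P p.K) (k + 1) // c ∉ (Set.toFinite (bondsIn (k + 1) Y)).toFinset} =>
            (HaarData.haar : Measure (SU N)))] Fᵢ) :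
    (slotsTOfRecord F N ν τ E w ppSel p g (k + 1) s') ∘
        ⇑(MeasurableEquiv.piEquivPiSubtypeProd (fun _ : PBond (F.P p.K) (k + 1) => SU N)
          (· ∈ (Set.toFinite (bondsIn (k + 1) Y)).toFinset)).symm
      =ᵐ[(Measure.pi fun _ : ↥(Set.toFinite (bondsIn (k + 1) Y)).toFinset => (HaarData.haar : Measure (SU N))).prod
          (Measure.pi fun _ : {c : PBond (F.P p.K) (k + 1) // c ∉ (Set.toFinite (bondsIn (k + 1) Y)).toFinset} =>
            (HaarData.haar : Measure (SU N)))]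
        fun q => kernelRTOfRecord F N p.K k (Set.toFinite (bondsIn k Y)).toFinset (Set.toFinite (bondsIn (k + 1) Y)).toFinset
          (fun y => Fᵢ (y, q.2)) q.1 := by
  rw [slotsTOfRecord_succ]
  exact tstepOfRecord_comp_glue_ae_eq_kernelRTOfRecord_bondsIn ν τ.M w p g hkK hk (slotsOfRecord F N ν τ E w ppSel p g k) s' hY hG hFm hin

/-- ★★★★′ **THE LEFT SIDE OF (O3′) THROUGH THE PRESENTATION, INNER FIBRE CHARTED**: §1's charted face at `T := slotsOfRecord … k` — for a measurable graph section of
the step weight vanishing off the charted set, measurable `χ_k(init s′)` and `slot_k(init s′)`, and the integrable graph integrand,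
`(slotsTOfRecord … (k+1) s′) ∘ e_α =ᵐ (V_out, r) ↦ kernelRTOfRecord F N K k sV sV' [y ↦ ∫ J((y,r),x) · (w(s′)(·, avg ·) · χ_k(init s′) · slot_k(init s′))(e_β (y, Ψ((y,r),x))) ∂κ(y,r)] V_out`.
[cite: Balaban1988Convergent, (2.21) p.258, (3.1) p.264, (3.23)–(3.25) p.270; Balaban1989LargeFieldI, (0.2)–(0.3) p.176 (bookkeeping)] -/
theorem slotsTOfRecord_succ_comp_glue_ae_eq_kernelRTOfRecord_of_innerChart (ν : Stage7Numerics) (τ : TowerNumerics) (E : B12.RunParams → ℝ)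
    (w : StepWeightsOfRecord F N ν τ.M) (ppSel : PpSelOfRecord F ν τ.M) (p : B12.RunParams) (g : ℕ → ℝ) {k : ℕ} (hkK : k < p.K)
    [DecidableEq (PBond (F.P p.K) k)] [DecidableEq (PBond (F.P p.K) (k + 1))] (hk : k + 1 ≤ (F.P p.K).m + (F.P p.K).K) (s' : SeqOfRecord F ν τ.M g p.K (k + 1))
    {Y : Set (Site (F.P p.K) 0)} (hY : ∀ s : Site (F.P p.K) k, toFine k s ∈ Y ↔ toFine (k + 1) (blockOf s) ∈ Y)
    {sV : Finset (PBond (F.P p.K) k)} (hsV : ∀ b : PBond (F.P p.K) k, b ∈ sV ↔ b ∈ bondsIn k Y)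
    {sV' : Finset (PBond (F.P p.K) (k + 1))} (hsV' : ∀ c : PBond (F.P p.K) (k + 1), c ∈ sV' ↔ c ∈ bondsIn (k + 1) Y)
    {X : Type*} [MeasurableSpace X]
    {κ : Kernel ((↥sV → SU N) × ({c : PBond (F.P p.K) (k + 1) // c ∉ sV'} → SU N)) X} [IsSFiniteKernel κ]
    {Ψ : ((↥sV → SU N) × ({c : PBond (F.P p.K) (k + 1) // c ∉ sV'} → SU N)) × X → ({b : PBond (F.P p.K) k // b ∉ sV} → SU N)}
    (hΨ : Measurable Ψ)
    {J : ((↥sV → SU N) × ({c : PBond (F.P p.K) (k + 1) // c ∉ sV'} → SU N)) × X → ℝ≥0} (hJ : Measurable J)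
    {S : Set ((↥sV → SU N) × ({b : PBond (F.P p.K) k // b ∉ sV} → SU N))}
    (hpush : ((((Measure.pi fun _ : ↥sV => (HaarData.haar : Measure (SU N))).prod
          (Measure.pi fun _ : {c : PBond (F.P p.K) (k + 1) // c ∉ sV'} => (HaarData.haar : Measure (SU N)))) ⊗ₘ κ).withDensity
          (fun z => (J z : ℝ≥0∞))).map (fun z => (z.1.1, Ψ z))
      = ((Measure.pi fun _ : ↥sV => (HaarData.haar : Measure (SU N))).prod
          (Measure.pi fun _ : {b : PBond (F.P p.K) k // b ∉ sV} => (HaarData.haar : Measure (SU N)))).restrict S)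
    (hfib : ∀ᵐ z ∂((((Measure.pi fun _ : ↥sV => (HaarData.haar : Measure (SU N))).prod
          (Measure.pi fun _ : {c : PBond (F.P p.K) (k + 1) // c ∉ sV'} => (HaarData.haar : Measure (SU N)))) ⊗ₘ κ).withDensity
          (fun z => (J z : ℝ≥0∞))),
      (fun c : {c : PBond (F.P p.K) (k + 1) // c ∉ sV'} =>
        (avOfRecord F N p.K k).avg ((MeasurableEquiv.piEquivPiSubtypeProd (fun _ : PBond (F.P p.K) k => SU N) (· ∈ sV)).symm
          (z.1.1, Ψ z)) c) = z.1.2)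
    (hw : Measurable fun U => w p g k s' U ((avOfRecord F N p.K k).avg U)) (hχ : Measurable (chiSeqOfRecord F N ν τ.M g p.K k s'.init))
    (hslot : Measurable (slotsOfRecord F N ν τ E w ppSel p g k s'.init))
    (hG : Integrable (fun U => w p g k s' U ((avOfRecord F N p.K k).avg U) *
      (chiSeqOfRecord F N ν τ.M g p.K k s'.init U * slotsOfRecord F N ν τ E w ppSel p g k s'.init U)) (fieldMeasure (F.P p.K) k (SU N)))
    (hwS : ∀ q, q ∉ S →
      w p g k s' ((MeasurableEquiv.piEquivPiSubtypeProd (fun _ : PBond (F.P p.K) k => SU N) (· ∈ sV)).symm q)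
        ((avOfRecord F N p.K k).avg ((MeasurableEquiv.piEquivPiSubtypeProd (fun _ : PBond (F.P p.K) k => SU N) (· ∈ sV)).symm q)) = 0) :
    (slotsTOfRecord F N ν τ E w ppSel p g (k + 1) s') ∘
        ⇑(MeasurableEquiv.piEquivPiSubtypeProd (fun _ : PBond (F.P p.K) (k + 1) => SU N) (· ∈ sV')).symm
      =ᵐ[(Measure.pi fun _ : ↥sV' => (HaarData.haar : Measure (SU N))).prod
          (Measure.pi fun _ : {c : PBond (F.P p.K) (k + 1) // c ∉ sV'} => (HaarData.haar : Measure (SU N)))]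
        fun v => kernelRTOfRecord F N p.K k sV sV'
          (fun y => ∫ x, (J ((y, v.2), x) : ℝ) *
            (fun U => w p g k s' U ((avOfRecord F N p.K k).avg U) *
                (chiSeqOfRecord F N ν τ.M g p.K k s'.init U * slotsOfRecord F N ν τ E w ppSel p g k s'.init U))
              ((MeasurableEquiv.piEquivPiSubtypeProd (fun _ : PBond (F.P p.K) k => SU N) (· ∈ sV)).symm (y, Ψ ((y, v.2), x))) ∂(κ (y, v.2)))
          v.1 := by
  rw [slotsTOfRecord_succ]
  exact tstepOfRecord_comp_glue_ae_eq_kernelRTOfRecord_of_innerChart ν τ.M w p g hkK hk (slotsOfRecord F N ν τ E w ppSel p g k) s' hY hsV hsV'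
    hΨ hJ hpush hfib hw hχ hslot hG hwS

end Slots

end Summit.QuantumFields.YangMills.Theorems.BalabanUVNodesN11TStepOfRecordSeparated

end
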